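import Mathlib
import HarnessLib
import Summits.HubbardSuperconductivity.HubbardSuperconductivity.Theorems.KLProgrammeKLRegimeSplitPairArrayV3

/-!
# Route `KLProgramme` — K3 child `KLRegimeBetaSplit` (stmt-HubbardSuperconductivity-19635), line `birth`, Stub 5:
# (B1-v2) `PairArrayAt` IN THE REGIME — row 0′ (`pairArrayAt_of_engineBoundsV3_explicit`, p3, p443936) with its four side
# conditions discharged from the KL regime, the `U`-smallness and the volume threshold

Where child 1 spends `β ≤ e^{c/U²}`: row 0′'s second smallness line `8·16·A_n·(bhi·n) ≤ 1` (no onset of the repulsive pair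
cascade within `n` scales) holds because `A_n ≤ Crow·U²` (`rowZero_majorant_le` with `2·CR·Klam³·U ≤ 1` and the volume term
absorbed: `rowZero_majorant_le_Crow`) and `U²·n·ln 4 ≤ c` (`IsKLRegime U c (-n)`, which the children receive from
`isKLRegime_of_le_tempScaleIdx`) and `c ≤ c₀ = ln 4 / (128·Crow·(bhi+1))` (`rowZero_hsmall`).  The first smallness line is
`U ≤ U₀`; the finite-volume line `17·Σ_{j<n} CL β j / L ≤ U²` is `L ≥ L₁ β U = ⌈17·Σ_{j ≤ n_β} CL β j / U²⌉₊` (`volume_line`).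
Everything is real arithmetic over landed theorems.  Cell gate-hubbard-kl, seat hubbard-kl-r2d-p1 (g0); registered stub of the
skeleton `Lines/birth.lean` of 19635.
-/

noncomputable section

namespace Summit.HubbardSuperconductivity.HubbardSuperconductivity.Theorems.KLRegimeSplit

set_option linter.dupNamespace false -- summit = problem name (single-conjunct summit), D-0017

open Real Finset Literature.MathematicalPhysics.QuantumLattice Literature.Probability.LatticeModels
open Summit.HubbardSuperconductivity.HubbardSuperconductivity.Theorems.KLProgrammeLegKernels
open Summit.HubbardSuperconductivity.HubbardSuperconductivity.Theorems.DispersionFlow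

/-- The `G,P`-part of the row-0′ majorant constant: `Crow = (Σ_χ(abot χ + atop χ) + 1) + 2·(aplus·Klam²·Z + cloc·Klam²·(1-4^{-θ})⁻¹ + 1) + 1`
(`rowZero_majorant_le`'s `c(G,P,Q,|U|)` with `2·CR·Klam³·|U| ≤ 1` and the volume term `2·Σ CL/L ≤ U²` absorbed). -/
theorem klbs_rowZero_majorant_le_Crow {G : GeoConsts} {P : SplitConsts} {Q : EngConsts} (hG : G.WF) (hP : P.WF) (hQ : Q.WF)
    {U β : ℝ} {L n : ℕ} (hUCR : 2 * Q.CR * P.Klam ^ 3 * |U| ≤ 1) (hL : 17 * ∑ j ∈ range n, Q.CL β j / L ≤ U ^ 2) :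
    initDevBar G U + 2 * ∑ j ∈ range n, (drivePBar G P U j + eremBar G P Q U β L j) ≤
      ((∑ χ : D4Irrep, (G.abot χ + G.atop χ) + 1) +
          2 * (G.aplus * P.Klam ^ 2 * G.Z + G.cloc * P.Klam ^ 2 * (1 - (4 : ℝ) ^ (-G.θ))⁻¹ + 1) + 1) * U ^ 2 := by
  have hmaj := rowZero_majorant_le (Qc := Q) hG hP hQ U β L n
  have hU2 : 0 ≤ U ^ 2 := sq_nonneg U
  have hCL0 : 0 ≤ ∑ j ∈ range n, Q.CL β j / L :=
    sum_nonneg fun j _ => div_nonneg (hQ.2.2.2.2.2.2.2 β j) (Nat.cast_nonneg L)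
  have hK0 : 0 ≤ P.Klam := zero_le_one.trans hP.1
  have hCR : 0 ≤ Q.CR := hQ.2.1
  have hCRU : 2 * (2 * Q.CR * P.Klam ^ 3 * |U|) * U ^ 2 ≤ 2 * U ^ 2 := by nlinarith
  nlinarith [hmaj, hCRU, hL, hCL0, mul_nonneg (mul_nonneg hCR (pow_nonneg hK0 3)) (abs_nonneg U)]

/-- **The two regime lines of row 0′.**  With `A_n ≤ Crow·U²`: `hsmall₁` from `bhi·(1 + 8·Crow)·U ≤ 1`, `0 < U ≤ 1`;
`hsmall₂` — the NO-ONSET line, where `β ≤ e^{c/U²}` is spent — from `IsKLRegime U c (-n)` (`U²·n·ln 4 ≤ c`) and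
`128·Crow·(bhi+1)·c ≤ ln 4` (i.e. `c ≤ c₀`). -/
theorem klbs_rowZero_hsmall {A Crow bhi U c : ℝ} {n : ℕ} (hA : A ≤ Crow * U ^ 2) (hCrow : 0 ≤ Crow)
    (hbhi : 0 ≤ bhi) (hU : 0 < U) (hU1 : U ≤ 1) (hb1 : bhi * (1 + 8 * Crow) * U ≤ 1) (hKL : IsKLRegime U c (-(n : ℤ)))
    (hc : 128 * Crow * (bhi + 1) * c ≤ Real.log 4) :
    bhi * (U + 8 * A) ≤ 1 ∧ 8 * 16 * A * (bhi * n) ≤ 1 := by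
  have hlog4 : 0 < Real.log 4 := Real.log_pos (by norm_num)
  have hU2U : U ^ 2 ≤ U := by nlinarith
  constructor
  · have h8 : 8 * A ≤ 8 * Crow * U := by nlinarith
    nlinarith [mul_nonneg hbhi (by positivity : (0 : ℝ) ≤ 8 * Crow * U)]
  · -- `U² n log 4 ≤ c`
    have hreg : U ^ 2 * (n : ℝ) * Real.log 4 ≤ c := by
      have h := hKL
      unfold IsKLRegime at h
      have habs : |((-(n : ℤ) : ℤ) : ℝ)| = (n : ℝ) := by
        rw [Int.cast_neg, Int.cast_natCast, abs_neg, Nat.abs_cast]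
      rwa [habs] at h
    have hn0 : (0 : ℝ) ≤ n := Nat.cast_nonneg n
    -- 128 A bhi n ≤ 128 Crow U² bhi n ≤ 128 Crow bhi c / log 4 ≤ (bhi/(bhi+1)) ≤ 1
    have h1 : 8 * 16 * A * (bhi * n) ≤ 128 * Crow * bhi * (U ^ 2 * n) := by
      nlinarith [mul_nonneg hbhi hn0]
    have h2 : 128 * Crow * bhi * (U ^ 2 * n) * Real.log 4 ≤ 128 * Crow * bhi * c := by
      have := mul_le_mul_of_nonneg_left hreg (by positivity : (0 : ℝ) ≤ 128 * Crow * bhi)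
      nlinarith
    have hc0 : 0 ≤ c := le_trans (by positivity) hreg
    have h3 : 128 * Crow * bhi * c ≤ 128 * Crow * (bhi + 1) * c := by nlinarith
    have h4 : 8 * 16 * A * (bhi * n) * Real.log 4 ≤ Real.log 4 := by nlinarith
    have h5 : 8 * 16 * A * (bhi * n) * Real.log 4 ≤ 1 * Real.log 4 := by linarith
    exact le_of_mul_le_mul_right h5 hlog4

/-- The volume threshold line: `L ≥ ⌈17·(Σ_{j ≤ N} CL β j)/U²⌉₊`, `n ≤ N`, `CL ≥ 0`, `U ≠ 0` give `17·Σ_{j<n} CL β j / L ≤ U²`. -/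
theorem klbs_volume_line {CL : ℝ → ℕ → ℝ} (hCL : ∀ β n, 0 ≤ CL β n) {β U : ℝ} (hU : 0 < U) {L N n : ℕ} [NeZero L]
    (hn : n ≤ N) (hL : ⌈17 * (∑ j ∈ range (N + 1), CL β j) / U ^ 2⌉₊ ≤ L) :
    17 * ∑ j ∈ range n, CL β j / L ≤ U ^ 2 := by
  have hLpos : (0 : ℝ) < L := Nat.cast_pos.mpr (Nat.pos_of_ne_zero (NeZero.ne L))
  have hU2 : 0 < U ^ 2 := by positivity
  have hS : ∑ j ∈ range n, CL β j ≤ ∑ j ∈ range (N + 1), CL β j :=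
    sum_le_sum_of_subset_of_nonneg (range_mono (by omega)) fun j _ _ => hCL β j
  have hceil : 17 * (∑ j ∈ range (N + 1), CL β j) / U ^ 2 ≤ (L : ℝ) := le_trans (Nat.le_ceil _) (by exact_mod_cast hL)
  rw [div_le_iff₀ hU2] at hceil
  rw [← sum_div, mul_div_assoc', div_le_iff₀ hLpos]
  nlinarith


/-- **Stub 5 of line `birth` (child `KLRegimeBetaSplit`): (B1-v2) `PairArrayAt … n` in the regime.**  From the engine bounds
`EngineBoundsAtV3 … j` at every `j ≤ n`, `P.C_W ≥` row 0′'s polynomial in `(G, Klam)`, the `U`-smallness lines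
`2·CR·Klam³·U ≤ 1` and `bhi·(1 + 8·Crow)·U ≤ 1`, the no-onset line `IsKLRegime U c (-n)` ∧ `128·Crow·(bhi+1)·c ≤ ln 4`, and the
volume line `⌈17·Σ_{j ≤ N} CL β j / U²⌉₊ ≤ L`, `n ≤ N` (with `Crow` written out). -/
theorem stub_pairArrayAtRegime :
    ∀ (L M : ℕ) [NeZero L] [NeZero M] (G : GeoConsts) (P : SplitConsts) (Q : EngConsts) (β U μ c : ℝ) (K : TrigPolyC4v)
      (n N : ℕ), G.WF → P.WF → Q.WF → 0 < U → U ≤ 1 →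
      8 * ((∑ χ : D4Irrep, (G.abot χ + G.atop χ) + 1) +
            2 * (G.aplus * P.Klam ^ 2 * G.Z + G.cloc * P.Klam ^ 2 * (1 - (4 : ℝ) ^ (-G.θ))⁻¹ + 1)) +
          3 * G.CF * P.Klam ^ 2 + G.cloc * P.Klam ^ 2 * (1 - (4 : ℝ) ^ (-G.θ))⁻¹ + 2 ≤ P.C_W →
      2 * Q.CR * P.Klam ^ 3 * U ≤ 1 →
      G.bhi * (1 + 8 * ((∑ χ : D4Irrep, (G.abot χ + G.atop χ) + 1) +
          2 * (G.aplus * P.Klam ^ 2 * G.Z + G.cloc * P.Klam ^ 2 * (1 - (4 : ℝ) ^ (-G.θ))⁻¹ + 1) + 1)) * U ≤ 1 →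
      IsKLRegime U c (-(n : ℤ)) →
      128 * ((∑ χ : D4Irrep, (G.abot χ + G.atop χ) + 1) +
          2 * (G.aplus * P.Klam ^ 2 * G.Z + G.cloc * P.Klam ^ 2 * (1 - (4 : ℝ) ^ (-G.θ))⁻¹ + 1) + 1) * (G.bhi + 1) * c ≤
        Real.log 4 →
      n ≤ N → ⌈17 * (∑ j ∈ range (N + 1), Q.CL β j) / U ^ 2⌉₊ ≤ L →
      (∀ j ≤ n, EngineBoundsAtV3 L M G P Q β U μ K j) → PairArrayAt L M P β U μ K n := by
  intro L M _ _ G P Q β U μ c K n N hG hP hQ hU hU1 hCW hUCR hUb hKL hc hnN hL hE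
  have hUa : |U| = U := abs_of_pos hU
  have hUCR' : 2 * Q.CR * P.Klam ^ 3 * |U| ≤ 1 := by rwa [hUa]
  have hCL : ∀ β n, 0 ≤ Q.CL β n := hQ.2.2.2.2.2.2.2
  have hLline : 17 * ∑ j ∈ range n, Q.CL β j / L ≤ U ^ 2 := klbs_volume_line hCL hU hnN hL
  have hA := klbs_rowZero_majorant_le_Crow (β := β) (L := L) (n := n) hG hP hQ hUCR' hLline
  -- nonnegativity
  have hbhi : 0 ≤ G.bhi := le_trans hG.2.2.1 hG.2.2.2.1
  have hcloc : 0 ≤ G.cloc := hG.2.2.2.2.1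
  have haplus : 0 ≤ G.aplus := hG.2.2.2.2.2.2.2.2.2.2.1
  have hθ : 0 < G.θ := hG.2.2.2.2.2.1
  have hZ : 0 ≤ G.Z := le_trans (sum_nonneg fun j _ => hG.2.2.2.2.2.2.2.2.1 j) (hG.2.2.2.2.2.2.2.2.2.1 0)
  have hab : 0 ≤ ∑ χ : D4Irrep, (G.abot χ + G.atop χ) := sum_nonneg fun χ _ => add_nonneg (hG.2.1 χ) (hG.1 χ)
  have hg : 0 ≤ (1 - (4 : ℝ) ^ (-G.θ))⁻¹ :=
    inv_nonneg.2 (by have := Real.rpow_lt_one_of_one_lt_of_neg (x := (4 : ℝ)) (by norm_num) (by linarith : -G.θ < 0); linarith)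
  have hK2 : 0 ≤ P.Klam ^ 2 := sq_nonneg _
  have hCrow : 0 ≤ (∑ χ : D4Irrep, (G.abot χ + G.atop χ) + 1) +
      2 * (G.aplus * P.Klam ^ 2 * G.Z + G.cloc * P.Klam ^ 2 * (1 - (4 : ℝ) ^ (-G.θ))⁻¹ + 1) + 1 := by
    have h1 : 0 ≤ G.aplus * P.Klam ^ 2 * G.Z := mul_nonneg (mul_nonneg haplus hK2) hZ
    have h2 : 0 ≤ G.cloc * P.Klam ^ 2 * (1 - (4 : ℝ) ^ (-G.θ))⁻¹ := mul_nonneg (mul_nonneg hcloc hK2) hg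
    positivity
  obtain ⟨hsmall₁, hsmall₂⟩ := klbs_rowZero_hsmall hA hCrow hbhi hU hU1 hUb hKL hc
  exact pairArrayAt_of_engineBoundsV3_explicit L M hG hP hQ hU.le hE hsmall₁ hsmall₂ hUCR' hLline hCW

end Summit.HubbardSuperconductivity.HubbardSuperconductivity.Theorems.KLRegimeSplit

end
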